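import Summits.Ventures.HodgeRepro2.T5SU11LegendreGeneratingFormal
import Summits.Ventures.HodgeRepro2.T5SU11SphericalLegendreCfun

/-!
# Heine's expansion of the spherical functions of even parameter:
`φ_{2n+2}(a_t) = P_n(cosh 2t) = Σ_{k ≤ n} a_k a_{n−k} e^{2(2k − n)t}`, `a_k = C(2k,k)/4^k`

The binomial coefficients `a_k := C(2k, k)/4^k` (`binomHalf`) are the coefficients of `(1 − z)^{−1/2}`: their
generating series `B := Σ_k a_k Tᵏ` (`binomSeries`) satisfies `(1 − T) B' = B/2` (the ratio
`(k + 1) a_{k+1} = (k + ½) a_k`, Mathlib's `Nat.succ_mul_centralBinom_succ`), hence **`B² (1 − T) = 1`**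
(`binomSeries_sq_mul`) — which is the classical binomial identity **`Σ_{k ≤ n} C(2k,k) C(2n−2k,n−k) = 4ⁿ`**
(`sum_centralBinom_mul_centralBinom`). With `x = cosh 2t` the quadratic factors, `1 − 2xT + T² =
(1 − e^{2t}T)(1 − e^{−2t}T)` (`legQuad_cosh`), so `H := B(e^{2t}T) · B(e^{−2t}T)` satisfies `H² · Q_x = 1` and
`H(0) = 1`; by the uniqueness of the square root (`T5SU11LegendreGeneratingFormal.eq_legSeries_of_sq_mul`)
**`Σ_n P_n(cosh 2t) Tⁿ = B(e^{2t}T) · B(e^{−2t}T)`** (`legSeries_cosh`), i.e. **Heine's formula**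

  **`P_n(cosh 2t) = Σ_{k ≤ n} a_k a_{n−k} e^{2kt} e^{−2(n−k)t}`**   (`legP_cosh_eq_sum`),

on the group **`φ_{2n+2}(a_t) = Σ_{k ≤ n} a_k a_{n−k} e^{(4k − 2n)t}`** (`sph_even_hyp_eq_sum`): the spherical function
of even integer parameter is an explicit exponential polynomial in the Cartan coordinate — the Harish-Chandra
expansion, finite at `λ = 2n + 2`, with leading coefficient `a_n = c(−2n)` (`binomHalf_eq_cfun`, row 371).
Consequences: **`e^{−2nt} P_n(cosh 2t) = Σ_{j ≤ n} a_{n−j} a_j e^{−4jt}`** (`exp_neg_mul_legP_cosh_eq`), the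
two-sided bound **`a_n ≤ e^{−2nt} P_n(cosh 2t) ≤ a_n + (1 − a_n) e^{−4t}`** for `t ≥ 0`
(`exp_neg_mul_legP_cosh_sub_le`), the limit `a_n` re-derived (`tendsto_exp_neg_mul_legP_cosh'`), and **the next
term**: `e^{4t} (e^{−2nt} P_n(cosh 2t) − c(−2n)) → a_{n−1}/2 = C(2n−2, n−1)/(2 · 4^{n−1})` for `n ≥ 1`
(`tendsto_exp_mul_sub_cfun`). Nothing is claimed about (N).

Blind lane: Mathlib + the HodgeRepro2 prefix only; no sorry; axioms ⊆ {propext, Classical.choice,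
Quot.sound}.
-/

namespace Summit.Ventures.HodgeRepro2.T5SU11LegendreHeine

open PowerSeries Finset Filter Topology
open T5SU11Cartan T5SU11SphericalFunction T5SU11SphericalLegendreAll T5SU11SphericalAsymptotic
  T5SU11SphericalLegendreCfun T5SU11LegendreGeneratingFormal

/-! ### The coefficients `a_k = C(2k,k)/4^k` of `(1 − z)^{−1/2}` -/

/-- **`a_k = C(2k, k)/4^k`.** -/
noncomputable def binomHalf (k : ℕ) : ℝ := ((2 * k).choose k : ℝ) / 4 ^ k

/-- `a_0 = 1`. -/
@[simp] theorem binomHalf_zero : binomHalf 0 = 1 := by simp [binomHalf]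

/-- `a_1 = 1/2`. -/
theorem binomHalf_one : binomHalf 1 = 1 / 2 := by
  simp [binomHalf]
  norm_num

/-- `a_k > 0`. -/
theorem binomHalf_pos (k : ℕ) : 0 < binomHalf k := by
  unfold binomHalf
  have : 0 < (2 * k).choose k := Nat.choose_pos (by omega)
  positivity

/-- **The ratio `(k + 1) a_{k+1} = (k + ½) a_k`** (Mathlib's `Nat.succ_mul_centralBinom_succ`). -/
theorem binomHalf_succ (k : ℕ) : ((k : ℝ) + 1) * binomHalf (k + 1) = ((k : ℝ) + 1 / 2) * binomHalf k := by
  have h := Nat.succ_mul_centralBinom_succ k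
  rw [Nat.centralBinom_eq_two_mul_choose, Nat.centralBinom_eq_two_mul_choose] at h
  have h' : ((k : ℝ) + 1) * ((2 * (k + 1)).choose (k + 1) : ℝ) = 2 * (2 * (k : ℝ) + 1) * ((2 * k).choose k : ℝ) := by
    exact_mod_cast h
  unfold binomHalf
  rw [pow_succ]
  field_simp
  linear_combination 2 * h'

/-- `a_n = (2n)!/(4ⁿ n!²)`. -/
theorem binomHalf_eq_factorial (n : ℕ) : binomHalf n = ((2 * n).factorial : ℝ) / (4 ^ n * (n.factorial : ℝ) ^ 2) := by
  have h := Nat.choose_mul_factorial_mul_factorial (show n ≤ 2 * n by omega)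
  rw [show 2 * n - n = n by omega] at h
  have h' : ((2 * n).choose n : ℝ) * (n.factorial : ℝ) * (n.factorial : ℝ) = ((2 * n).factorial : ℝ) := by
    exact_mod_cast h
  unfold binomHalf
  rw [div_eq_div_iff (by positivity) (by positivity)]
  linear_combination (4 : ℝ) ^ n * h'

/-- **`a_n = c(−2n)`**: the leading coefficient is the `c`-function at `−2n` (row 371). -/
theorem binomHalf_eq_cfun (n : ℕ) : binomHalf n = cfun (-(2 * (n : ℝ))) := by
  rw [cfun_neg_two_mul, binomHalf_eq_factorial]

/-! ### The binomial series `B = Σ_k a_k Tᵏ` and `B² (1 − T) = 1` -/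

/-- **`B = Σ_k a_k Tᵏ`**, the series of `(1 − T)^{−1/2}`. -/
noncomputable def binomSeries : ℝ⟦X⟧ := PowerSeries.mk binomHalf

/-- `coeff k B = a_k`. -/
@[simp] theorem coeff_binomSeries (k : ℕ) : coeff k binomSeries = binomHalf k := coeff_mk k _

/-- `B(0) = 1`. -/
theorem constantCoeff_binomSeries : constantCoeff binomSeries = 1 := by
  rw [← coeff_zero_eq_constantCoeff_apply, coeff_binomSeries, binomHalf_zero]

/-- **`(1 − T) B' = B/2`**: the ratio of the coefficients as a differential equation. -/
theorem one_sub_X_mul_derivative : (1 - X) * d⁄dX ℝ binomSeries = C (1 / 2 : ℝ) * binomSeries := by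
  have e : (1 - X) * d⁄dX ℝ binomSeries = d⁄dX ℝ binomSeries - X * d⁄dX ℝ binomSeries := by ring
  rw [e]
  ext n
  rw [map_sub, coeff_C_mul]
  rcases n with _ | n
  · simp only [coeff_derivative, coeff_zero_X_mul, coeff_binomSeries, Nat.cast_zero, zero_add, mul_one, sub_zero,
      binomHalf_zero, binomHalf_one]
  · rw [coeff_succ_X_mul, coeff_derivative, coeff_derivative]
    simp only [coeff_binomSeries]
    have h := binomHalf_succ (n + 1)
    push_cast at h ⊢
    linear_combination h

/-- **`B² (1 − T) = 1`**: `B = (1 − T)^{−1/2}`. -/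
theorem binomSeries_sq_mul : binomSeries * binomSeries * (1 - X) = 1 := by
  refine PowerSeries.derivative.ext ?_ ?_
  · rw [Derivation.map_one_eq_zero, Derivation.leibniz, Derivation.leibniz, map_sub, Derivation.map_one_eq_zero,
      derivative_X, smul_eq_mul, smul_eq_mul, smul_eq_mul]
    have h := one_sub_X_mul_derivative
    have hC : (C (1 / 2 : ℝ) : ℝ⟦X⟧) * 2 = 1 := by
      rw [← map_ofNat C 2, ← map_mul]
      norm_num
    linear_combination (2 * binomSeries) * h + (binomSeries * binomSeries) * hC
  · rw [map_mul, map_mul, constantCoeff_binomSeries, map_sub, map_one, constantCoeff_X]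
    ring

/-- `coeff n (B²) = 1` for every `n`. -/
theorem coeff_binomSeries_sq (n : ℕ) : coeff n (binomSeries * binomSeries) = 1 := by
  have h := binomSeries_sq_mul
  have e : binomSeries * binomSeries = 1 + (binomSeries * binomSeries) * X := by
    linear_combination h
  induction n with
  | zero =>
    rw [coeff_zero_eq_constantCoeff_apply, map_mul, constantCoeff_binomSeries, mul_one]
  | succ n ih =>
    rw [e, map_add, coeff_succ_mul_X, ih, coeff_one]
    simp

/-- **`Σ_{i+j=n} a_i a_j = 1`**: the convolution squares of `(1 − z)^{−1/2}` are those of `(1 − z)^{−1}`. -/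
theorem sum_antidiagonal_binomHalf (n : ℕ) :
    ∑ ij ∈ antidiagonal n, binomHalf ij.1 * binomHalf ij.2 = 1 := by
  have h := coeff_binomSeries_sq n
  rw [coeff_mul] at h
  simpa only [coeff_binomSeries] using h

/-- The same over `range (n + 1)`. -/
theorem sum_range_binomHalf (n : ℕ) : ∑ k ∈ range (n + 1), binomHalf k * binomHalf (n - k) = 1 := by
  rw [← sum_antidiagonal_binomHalf n, Finset.Nat.sum_antidiagonal_eq_sum_range_succ_mk]

/-- **The binomial identity `Σ_{k ≤ n} C(2k, k) C(2(n − k), n − k) = 4ⁿ`.** -/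
theorem sum_centralBinom_mul_centralBinom (n : ℕ) :
    ∑ k ∈ range (n + 1), (2 * k).choose k * (2 * (n - k)).choose (n - k) = 4 ^ n := by
  have h := sum_range_binomHalf n
  have e : ∀ k ∈ range (n + 1), binomHalf k * binomHalf (n - k)
      = (((2 * k).choose k * (2 * (n - k)).choose (n - k) : ℕ) : ℝ) / 4 ^ n := fun k hk => by
    have hk' : k ≤ n := Nat.lt_succ_iff.mp (Finset.mem_range.mp hk)
    unfold binomHalf
    rw [div_mul_div_comm, ← pow_add, Nat.add_sub_cancel' hk']
    push_cast
    ring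
  rw [Finset.sum_congr rfl e, ← Finset.sum_div, div_eq_one_iff_eq (by positivity)] at h
  exact_mod_cast h

/-! ### Heine's expansion -/

/-- `B(cT)² (1 − cT) = 1`. -/
theorem rescale_binomSeries_sq_mul (c : ℝ) :
    rescale c binomSeries * rescale c binomSeries * (1 - C c * X) = 1 := by
  have h := congrArg (rescale c) binomSeries_sq_mul
  rwa [map_mul, map_mul, map_sub, map_one, rescale_X] at h

/-- `B(cT)(0) = 1`. -/
theorem constantCoeff_rescale_binomSeries (c : ℝ) : constantCoeff (rescale c binomSeries) = 1 := by
  rw [← coeff_zero_eq_constantCoeff_apply, coeff_rescale, pow_zero, one_mul, coeff_binomSeries, binomHalf_zero]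

/-- **The quadratic factors at `x = cosh 2t`**: `1 − 2 cosh(2t) T + T² = (1 − e^{2t}T)(1 − e^{−2t}T)`. -/
theorem legQuad_cosh (t : ℝ) :
    legQuad (Real.cosh (2 * t)) = (1 - C (Real.exp (2 * t)) * X) * (1 - C (Real.exp (-(2 * t))) * X) := by
  have h1 : (C (Real.exp (2 * t)) : ℝ⟦X⟧) * C (Real.exp (-(2 * t))) = 1 := by
    rw [← map_mul, ← Real.exp_add, add_neg_cancel, Real.exp_zero, map_one]
  have h2 : (C (2 * Real.cosh (2 * t)) : ℝ⟦X⟧) = C (Real.exp (2 * t)) + C (Real.exp (-(2 * t))) := by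
    rw [← map_add]
    congr 1
    rw [Real.cosh_eq]
    ring
  rw [legQuad, h2]
  linear_combination (-(X ^ 2 : ℝ⟦X⟧)) * h1

/-- **`Σ_n P_n(cosh 2t) Tⁿ = B(e^{2t}T) · B(e^{−2t}T)`**, by the uniqueness of the square root. -/
theorem legSeries_cosh (t : ℝ) :
    legSeries (Real.cosh (2 * t)) = rescale (Real.exp (2 * t)) binomSeries * rescale (Real.exp (-(2 * t))) binomSeries := by
  symm
  refine eq_legSeries_of_sq_mul _ ?_ ?_
  · rw [legQuad_cosh]
    calc rescale (Real.exp (2 * t)) binomSeries * rescale (Real.exp (-(2 * t))) binomSeries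
          * (rescale (Real.exp (2 * t)) binomSeries * rescale (Real.exp (-(2 * t))) binomSeries)
          * ((1 - C (Real.exp (2 * t)) * X) * (1 - C (Real.exp (-(2 * t))) * X))
        = (rescale (Real.exp (2 * t)) binomSeries * rescale (Real.exp (2 * t)) binomSeries
            * (1 - C (Real.exp (2 * t)) * X))
          * (rescale (Real.exp (-(2 * t))) binomSeries * rescale (Real.exp (-(2 * t))) binomSeries
            * (1 - C (Real.exp (-(2 * t))) * X)) := by ring
      _ = 1 := by rw [rescale_binomSeries_sq_mul, rescale_binomSeries_sq_mul, one_mul]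
  · rw [map_mul, constantCoeff_rescale_binomSeries, constantCoeff_rescale_binomSeries, one_mul]

/-- **Heine's formula**: `P_n(cosh 2t) = Σ_{k ≤ n} a_k a_{n−k} e^{2kt} e^{−2(n−k)t}`. -/
theorem legP_cosh_eq_sum (n : ℕ) (t : ℝ) :
    legP n (Real.cosh (2 * t))
      = ∑ k ∈ range (n + 1), binomHalf k * binomHalf (n - k) * (Real.exp (2 * t) ^ k * Real.exp (-(2 * t)) ^ (n - k)) := by
  have h := congrArg (coeff n) (legSeries_cosh t)
  rw [coeff_legSeries, coeff_mul, Finset.Nat.sum_antidiagonal_eq_sum_range_succ_mk] at h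
  rw [h]
  refine Finset.sum_congr rfl fun k _ => ?_
  simp only [coeff_rescale, coeff_binomSeries]
  ring

/-- Heine's formula with a single exponential: `P_n(cosh 2t) = Σ_{k ≤ n} a_k a_{n−k} e^{(4k − 2n)t}`. -/
theorem legP_cosh_eq_sum_exp (n : ℕ) (t : ℝ) :
    legP n (Real.cosh (2 * t))
      = ∑ k ∈ range (n + 1), binomHalf k * binomHalf (n - k) * Real.exp ((4 * (k : ℝ) - 2 * n) * t) := by
  rw [legP_cosh_eq_sum]
  refine Finset.sum_congr rfl fun k hk => ?_
  have hk' : k ≤ n := Nat.lt_succ_iff.mp (Finset.mem_range.mp hk)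
  rw [← Real.exp_nat_mul, ← Real.exp_nat_mul, ← Real.exp_add, Nat.cast_sub hk']
  congr 2
  ring

section measure

variable [MeasurableSpace Circle] [BorelSpace Circle]

/-- **On the group: `φ_{2n+2}(a_t) = Σ_{k ≤ n} a_k a_{n−k} e^{(4k − 2n)t}`** — the Harish-Chandra expansion of the
spherical function of even integer parameter, a finite exponential polynomial in the Cartan coordinate. -/
theorem sph_even_hyp_eq_sum (n : ℕ) (t : ℝ) :
    sph (2 * (n : ℝ) + 2) (hyp t)
      = ∑ k ∈ range (n + 1), binomHalf k * binomHalf (n - k) * Real.exp ((4 * (k : ℝ) - 2 * n) * t) := by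
  rw [sph_even_hyp, legP_cosh_eq_sum_exp]

end measure

/-! ### The leading term and the next term -/

/-- **`e^{−2nt} P_n(cosh 2t) = Σ_{j ≤ n} a_{n−j} a_j e^{−4jt}`.** -/
theorem exp_neg_mul_legP_cosh_eq (n : ℕ) (t : ℝ) :
    Real.exp (-(2 * (n : ℝ)) * t) * legP n (Real.cosh (2 * t))
      = ∑ j ∈ range (n + 1), binomHalf (n - j) * binomHalf j * Real.exp (-(4 * (j : ℝ)) * t) := by
  rw [legP_cosh_eq_sum_exp, Finset.mul_sum, ← Finset.sum_range_reflect]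
  refine Finset.sum_congr rfl fun j hj => ?_
  have hj' : j ≤ n := Nat.lt_succ_iff.mp (Finset.mem_range.mp hj)
  rw [show n + 1 - 1 - j = n - j by omega, Nat.sub_sub_self hj', ← mul_assoc, mul_comm (Real.exp _), mul_assoc,
    ← Real.exp_add, Nat.cast_sub hj']
  congr 2
  ring

/-- The `j = 0` term split off: `e^{−2nt} P_n(cosh 2t) = a_n + Σ_{j < n} a_{n−j−1} a_{j+1} e^{−4(j+1)t}`. -/
theorem exp_neg_mul_legP_cosh_eq' (n : ℕ) (t : ℝ) :
    Real.exp (-(2 * (n : ℝ)) * t) * legP n (Real.cosh (2 * t))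
      = binomHalf n + ∑ j ∈ range n, binomHalf (n - (j + 1)) * binomHalf (j + 1) * Real.exp (-(4 * ((j : ℝ) + 1)) * t) := by
  rw [exp_neg_mul_legP_cosh_eq, Finset.sum_range_succ']
  simp only [Nat.sub_zero, binomHalf_zero, mul_one, Nat.cast_zero, mul_zero, neg_zero, zero_mul, Real.exp_zero]
  rw [add_comm]
  congr 1
  refine Finset.sum_congr rfl fun j _ => ?_
  push_cast
  ring_nf

/-- **Two-sided bound**: `a_n ≤ e^{−2nt} P_n(cosh 2t) ≤ a_n + (1 − a_n) e^{−4t}` for `t ≥ 0`. -/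
theorem exp_neg_mul_legP_cosh_sub_le (n : ℕ) {t : ℝ} (ht : 0 ≤ t) :
    binomHalf n ≤ Real.exp (-(2 * (n : ℝ)) * t) * legP n (Real.cosh (2 * t))
      ∧ Real.exp (-(2 * (n : ℝ)) * t) * legP n (Real.cosh (2 * t))
          ≤ binomHalf n + (1 - binomHalf n) * Real.exp (-(4 * t)) := by
  rw [exp_neg_mul_legP_cosh_eq']
  have hsum : ∑ j ∈ range n, binomHalf (n - (j + 1)) * binomHalf (j + 1) = 1 - binomHalf n := by
    have h := sum_range_binomHalf n
    rw [Finset.sum_range_succ', Nat.sub_zero, binomHalf_zero, one_mul] at h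
    have e : ∀ j ∈ range n, binomHalf (n - (j + 1)) * binomHalf (j + 1) = binomHalf (j + 1) * binomHalf (n - (j + 1)) :=
      fun j _ => mul_comm _ _
    rw [Finset.sum_congr rfl e]
    linarith
  constructor
  · have : 0 ≤ ∑ j ∈ range n, binomHalf (n - (j + 1)) * binomHalf (j + 1) * Real.exp (-(4 * ((j : ℝ) + 1)) * t) :=
      Finset.sum_nonneg fun j _ => by
        have := binomHalf_pos (n - (j + 1)); have := binomHalf_pos (j + 1); positivity
    linarith
  · rw [← hsum, Finset.sum_mul]
    refine add_le_add le_rfl (Finset.sum_le_sum fun j _ => ?_)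
    have hb : 0 ≤ binomHalf (n - (j + 1)) * binomHalf (j + 1) := by
      have := binomHalf_pos (n - (j + 1)); have := binomHalf_pos (j + 1); positivity
    refine mul_le_mul_of_nonneg_left (Real.exp_le_exp.mpr ?_) hb
    have : (0 : ℝ) ≤ j := Nat.cast_nonneg j
    nlinarith

/-- `e^{−ct} → 0` as `t → ∞` for `c > 0`. -/
theorem tendsto_exp_neg_mul_atTop {c : ℝ} (hc : 0 < c) :
    Tendsto (fun t : ℝ => Real.exp (-c * t)) atTop (𝓝 0) :=
  Real.tendsto_exp_atBot.comp (tendsto_id.const_mul_atTop_of_neg (by linarith))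

/-- The limit `e^{−2nt} P_n(cosh 2t) → a_n = c(−2n)` (row 371 re-derived from Heine's formula). -/
theorem tendsto_exp_neg_mul_legP_cosh' (n : ℕ) :
    Tendsto (fun t => Real.exp (-(2 * (n : ℝ)) * t) * legP n (Real.cosh (2 * t))) atTop (𝓝 (binomHalf n)) := by
  have hf : (fun t => Real.exp (-(2 * (n : ℝ)) * t) * legP n (Real.cosh (2 * t)))
      = fun t => binomHalf n + ∑ j ∈ range n, binomHalf (n - (j + 1)) * binomHalf (j + 1)
          * Real.exp (-(4 * ((j : ℝ) + 1)) * t) := by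
    funext t
    exact exp_neg_mul_legP_cosh_eq' n t
  rw [hf]
  have key : ∀ j : ℕ, Tendsto (fun t => binomHalf (n - (j + 1)) * binomHalf (j + 1) * Real.exp (-(4 * ((j : ℝ) + 1)) * t))
      atTop (𝓝 (binomHalf (n - (j + 1)) * binomHalf (j + 1) * 0)) := fun j =>
    (tendsto_exp_neg_mul_atTop (by positivity)).const_mul _
  have h := (tendsto_const_nhds (x := binomHalf n)).add (tendsto_finsetSum (range n) fun j _ => key j)
  simpa using h

/-- **The next term**: `e^{4t} (e^{−2nt} P_n(cosh 2t) − c(−2n)) → a_{n−1}/2 = C(2n−2, n−1)/(2 · 4^{n−1})` for `n ≥ 1`. -/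
theorem tendsto_exp_mul_sub_cfun {n : ℕ} (hn : 1 ≤ n) :
    Tendsto (fun t => Real.exp (4 * t) * (Real.exp (-(2 * (n : ℝ)) * t) * legP n (Real.cosh (2 * t)) - cfun (-(2 * (n : ℝ)))))
      atTop (𝓝 (binomHalf (n - 1) / 2)) := by
  rw [← binomHalf_eq_cfun]
  obtain ⟨m, rfl⟩ : ∃ m, n = m + 1 := ⟨n - 1, by omega⟩
  rw [Nat.add_sub_cancel]
  have e : ∀ t : ℝ, ∀ j ∈ range m,
      Real.exp (4 * t) * (binomHalf (m + 1 - (j + 1 + 1)) * binomHalf (j + 1 + 1)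
        * Real.exp (-(4 * (((j + 1 : ℕ) : ℝ) + 1)) * t))
      = binomHalf (m + 1 - (j + 1 + 1)) * binomHalf (j + 1 + 1) * Real.exp (-(4 * ((j : ℝ) + 1)) * t) := by
    intro t j _
    rw [← mul_assoc, mul_comm (Real.exp _), mul_assoc, ← Real.exp_add]
    congr 2
    push_cast
    ring
  have e0 : ∀ t : ℝ, Real.exp (4 * t) * (binomHalf (m + 1 - (0 + 1)) * binomHalf (0 + 1)
      * Real.exp (-(4 * (((0 : ℕ) : ℝ) + 1)) * t)) = binomHalf m / 2 := by
    intro t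
    rw [← mul_assoc, mul_comm (Real.exp _), mul_assoc, ← Real.exp_add]
    simp only [Nat.cast_zero, zero_add, Nat.add_sub_cancel, binomHalf_one]
    rw [show 4 * t + -(4 * (1 : ℝ)) * t = 0 by ring, Real.exp_zero]
    ring
  have hf : (fun t => Real.exp (4 * t) * (Real.exp (-(2 * ((m + 1 : ℕ) : ℝ)) * t) * legP (m + 1) (Real.cosh (2 * t))
        - binomHalf (m + 1)))
      = fun t => ∑ j ∈ range m, binomHalf (m + 1 - (j + 1 + 1)) * binomHalf (j + 1 + 1)
          * Real.exp (-(4 * ((j : ℝ) + 1)) * t) + binomHalf m / 2 := by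
    funext t
    rw [exp_neg_mul_legP_cosh_eq', add_sub_cancel_left, Finset.mul_sum, Finset.sum_range_succ', e0 t,
      Finset.sum_congr rfl (e t)]
  rw [hf]
  have key : ∀ j : ℕ, Tendsto (fun t => binomHalf (m + 1 - (j + 1 + 1)) * binomHalf (j + 1 + 1)
      * Real.exp (-(4 * ((j : ℝ) + 1)) * t)) atTop (𝓝 (binomHalf (m + 1 - (j + 1 + 1)) * binomHalf (j + 1 + 1) * 0)) :=
    fun j => (tendsto_exp_neg_mul_atTop (by positivity)).const_mul _
  have h := (tendsto_finsetSum (range m) fun j _ => key j).add (tendsto_const_nhds (x := binomHalf m / 2))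
  simpa using h

end Summit.Ventures.HodgeRepro2.T5SU11LegendreHeine
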